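import Mathlib.Geometry.Manifold.VectorBundle.Tangent
import Mathlib.Geometry.Manifold.MFDeriv.Atlas
import Mathlib.Geometry.Manifold.ContMDiffMFDeriv
import Mathlib.Geometry.Manifold.VectorBundle.ContMDiffSection
import Mathlib.Geometry.Manifold.Immersion
import Mathlib.LinearAlgebra.Determinant
import Mathlib.Topology.Instances.Matrix
import Mathlib.Topology.Algebra.Module.FiniteDimension
import Literature.Topology.FourManifolds.OrientationSign
import Literature.Topology.FourManifolds.ChartDerivative
import HarnessLib

/-!
# Continuous frames along a map: chart readings, continuous coordinates, local smooth sections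

Topic `Literature/Topology/FourManifolds`; infrastructure for the discharge of the named fact
`Literature.Topology.FourManifolds.FreedmanQuinn1990_whitneyMove` (`FramedWhitneyDisc.lean`),
where the framing field of a framed Whitney disc — a merely *continuous* section of `TX` along
the disc (Milnor 1965, Lemma 6.13, frames over the Whitney disc; Lemma 6.11, their smoothing) —
has to be turned into smooth vector fields on `X`.  The smoothing itself is Mathlib's
`exists_contMDiffSection_forall_mem_convex_of_local` (smooth sections with values in fibrewise
convex sets); what that theorem consumes is provided here, for a `C^∞` manifold `M` over a real
model `I` on `E`:

* **chart readings** of a section `σ` of `TM` along a map `G : T → M` (`T` any space): the vector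
  `tangentCoordChange I (G t) x₀ (G t) (σ t)`, i.e. `σ t` read in the preferred chart at `x₀`;
  a section continuous into `TM` has continuous readings and conversely
  (`ContinuousOn.tangentCoordChange_section`, `continuousOn_totalSpaceMk_of_tangentCoordChange`),
  so that continuous combinations of continuous sections along `G` are continuous
  (`continuousOn_totalSpaceMk_sum_smul`);
* **continuous coordinates** (`exists_continuousOn_coord_of_frame`, abstract form
  `exists_continuousOn_coord`): if `f t = (f t 0, …, f t (n-1))` is a frame of `T_{G t} M`
  depending continuously on `t ∈ R` (each `f · i` continuous into `TM`, `dim E = n`) and `σ` is a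
  continuous section along `G`, the coordinates of `σ t` in the frame `f t` are continuous on `R`
  (Cramer's rule in a chart reading: Mathlib's `Module.Basis.det_smul_mk_coord_eq_det_update`,
  continuity of determinants from the tree's `continuous_basis_det`, `OrientationSign.lean`);
* **smooth local sections with prescribed chart reading** (`contMDiffOn_sectionOfCoords`, with
  the tree's `tangentCoordChange_tangentCoordChange`, `ChartDerivative.lean`): for `g : M → E`
  smooth on the chart domain of `x₀`, the section `y ↦ tangentCoordChange I x₀ y y (g y)` is a
  `C^∞` section of `TM` there whose reading at `x₀` is `g`;
* a local smooth left inverse of an immersion and the extension of a pushed-forward vector field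
  off an immersed sheet (`exists_local_leftInverse_of_isImmersionAt`,
  `exists_section_extending_pushforward`).

Everything here is proved; no definitions, no named facts.

## References

* J. Milnor, *Lectures on the h-cobordism theorem*, notes by L. Siebenmann and J. Sondow,
  Princeton Mathematical Notes (1965), Lemmas 6.11, 6.13 (PDF pp. 43–45). [MilnorHCobordism1965]
* N. Steenrod, *The Topology of Fibre Bundles* (1951), §7 (coordinates in a moving frame).
  [Steenrod1951]
-/

open scoped Manifold ContDiff Topology
open Set Function Filter Bundle Module

noncomputable section

namespace Literature.Topology.FourManifolds

/-! ### Continuous coordinates with respect to a continuously moving frame (abstract form) -/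

section Abstract

variable {V : Type*} [NormedAddCommGroup V] [NormedSpace ℝ V] [FiniteDimensional ℝ V]
  {T : Type*} [TopologicalSpace T] {n : ℕ}

omit [FiniteDimensional ℝ V] in
/-- **Coordinates in a moving frame, by Cramer's rule.**  For a linearly independent family `v`
of `n = dim V` vectors and any vector `w`, the `i`-th coordinate of `w` in the basis `v` is
`det (update v i w) / det v` (determinants with respect to any fixed basis `e`).
[folklore] -/
theorem mk_coord_eq_det_update_div (e : Basis (Fin n) ℝ V) {v : Fin n → V}
    (hli : LinearIndependent ℝ v) (hsp : ⊤ ≤ Submodule.span ℝ (range v)) (i : Fin n) (w : V) :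
    (Basis.mk hli hsp).coord i w = e.det (update v i w) / e.det v := by
  have hunit : IsUnit (e.det v) := (Module.Basis.is_basis_iff_det e).1 ⟨hli, top_le_iff.1 hsp⟩
  have hne : e.det v ≠ 0 := hunit.ne_zero
  have key := congrArg (fun L : V →ₗ[ℝ] ℝ => L w)
    (Module.Basis.det_smul_mk_coord_eq_det_update e hli hsp i)
  simp only [LinearMap.smul_apply, smul_eq_mul, MultilinearMap.toLinearMap_apply,
    AlternatingMap.coe_multilinearMap] at key
  rw [eq_div_iff hne, mul_comm]
  exact key

/-- **Continuity of coordinates in a continuously moving frame (abstract form).**  Let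
`f t = (f t i)_{i < n}` be linearly independent families of `n = dim V` vectors and `σ t` vectors,
`t ∈ R`.  Suppose that about every `t₀ ∈ R` there are a relative neighbourhood `R₀ ⊆ R` and
injective linear "readings" `L t : V → V` such that `t ↦ L t (f t i)` and `t ↦ L t (σ t)` are
continuous on `R₀`.  Then the coordinates `c t` of `σ t` in the frame `f t` (`σ t = ∑ c t i • f t i`,
uniquely) are continuous on `R`. [cite: Steenrod1951, §7] -/
theorem exists_continuousOn_coord (hn : finrank ℝ V = n) {f : T → Fin n → V} {σ : T → V}
    {R : Set T} (hli : ∀ t ∈ R, LinearIndependent ℝ (f t))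
    (hloc : ∀ t₀ ∈ R, ∃ R₀ : Set T, R₀ ⊆ R ∧ R₀ ∈ 𝓝[R] t₀ ∧ ∃ L : T → V →L[ℝ] V,
      (∀ t ∈ R₀, Injective (L t)) ∧ (∀ i, ContinuousOn (fun t => L t (f t i)) R₀) ∧
        ContinuousOn (fun t => L t (σ t)) R₀) :
    ∃ c : T → Fin n → ℝ, (∀ i, ContinuousOn (fun t => c t i) R) ∧
      (∀ t ∈ R, σ t = ∑ i, c t i • f t i) ∧
      (∀ t ∈ R, ∀ d : Fin n → ℝ, σ t = ∑ i, d i • f t i → d = c t) := by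
  classical
  -- spanning
  have hsp : ∀ t ∈ R, ⊤ ≤ Submodule.span ℝ (range (f t)) := fun t ht =>
    ((hli t ht).span_eq_top_of_card_eq_finrank' (by simp [hn])).ge
  -- the coordinates
  set c : T → Fin n → ℝ := fun t i =>
    if ht : t ∈ R then (Basis.mk (hli t ht) (hsp t ht)).coord i (σ t) else 0 with hc
  have hc_eq : ∀ t (ht : t ∈ R) i, c t i = (Basis.mk (hli t ht) (hsp t ht)).coord i (σ t) :=
    fun t ht i => by simp [hc, ht]
  -- expansion and uniqueness
  have hexp : ∀ t ∈ R, σ t = ∑ i, c t i • f t i := by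
    intro t ht
    set b := Basis.mk (hli t ht) (hsp t ht) with hb
    have hbf : ∀ i, b i = f t i := fun i => Basis.mk_apply (hli t ht) (hsp t ht) i
    conv_lhs => rw [← b.sum_repr (σ t)]
    refine Finset.sum_congr rfl fun i _ => ?_
    rw [hbf, hc_eq t ht i]
    rfl
  have huniq : ∀ t ∈ R, ∀ d : Fin n → ℝ, σ t = ∑ i, d i • f t i → d = c t := by
    intro t ht d hd
    have h1 : ∑ i, (d i - c t i) • f t i = 0 := by
      simp only [sub_smul, Finset.sum_sub_distrib, ← hd, ← hexp t ht, sub_self]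
    funext i
    have := Fintype.linearIndependent_iff.1 (hli t ht) (fun i => d i - c t i) h1 i
    linarith
  refine ⟨c, fun i => ?_, hexp, huniq⟩
  -- continuity, locally through the readings
  intro t₀ ht₀
  obtain ⟨R₀, hR₀R, hR₀, L, hLinj, hLf, hLσ⟩ := hloc t₀ ht₀
  -- a fixed reference basis of `V`
  set e : Basis (Fin n) ℝ V := Module.finBasisOfFinrankEq ℝ V hn with he
  -- the read frame is a frame, and the coordinates are the same
  have hli' : ∀ t ∈ R₀, LinearIndependent ℝ (fun i => L t (f t i)) := fun t ht =>
    (hli t (hR₀R ht)).map' (L t).toLinearMap (LinearMap.ker_eq_bot.2 (hLinj t ht))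
  have hsp' : ∀ t ∈ R₀, ⊤ ≤ Submodule.span ℝ (range fun i => L t (f t i)) := fun t ht =>
    ((hli' t ht).span_eq_top_of_card_eq_finrank' (by simp [hn])).ge
  have hcoord : ∀ t (ht : t ∈ R₀),
      c t i = (Basis.mk (hli' t ht) (hsp' t ht)).coord i (L t (σ t)) := by
    intro t ht
    set b' := Basis.mk (hli' t ht) (hsp' t ht) with hb'
    have hb'f : ∀ j, b' j = L t (f t j) := fun j => Basis.mk_apply (hli' t ht) (hsp' t ht) j
    -- `L t (σ t) = ∑ c t j • L t (f t j)`, so its coordinates are `c t`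
    have h1 : L t (σ t) = ∑ j, c t j • b' j := by
      conv_lhs => rw [hexp t (hR₀R ht)]
      simp [map_sum, map_smul, hb'f]
    show c t i = b'.repr (L t (σ t)) i
    rw [h1, b'.repr_sum_self]
  -- Cramer's rule in the reading: a quotient of continuous determinants
  have hformula : ∀ t ∈ R₀, c t i =
      e.det (update (fun j => L t (f t j)) i (L t (σ t))) / e.det (fun j => L t (f t j)) :=
    fun t ht => by rw [hcoord t ht, mk_coord_eq_det_update_div e (hli' t ht) (hsp' t ht)]
  have hF : ContinuousOn (fun t => fun j => L t (f t j)) R₀ :=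
    continuousOn_pi.2 fun j => hLf j
  have hden : ContinuousOn (fun t => e.det fun j => L t (f t j)) R₀ :=
    (continuous_basis_det e).comp_continuousOn hF
  have hnum : ContinuousOn (fun t => e.det (update (fun j => L t (f t j)) i (L t (σ t)))) R₀ := by
    have hu : ContinuousOn (fun t => update (fun j => L t (f t j)) i (L t (σ t))) R₀ :=
      continuousOn_pi.2 fun j => by
        by_cases hj : j = i
        · subst hj
          simpa using hLσ
        · simpa [hj] using hLf j
    exact (continuous_basis_det e).comp_continuousOn hu
  have hne : ∀ t ∈ R₀, (e.det fun j => L t (f t j)) ≠ 0 := fun t ht =>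
    ((Module.Basis.is_basis_iff_det e).1 ⟨hli' t ht, top_le_iff.1 (hsp' t ht)⟩).ne_zero
  have hq : ContinuousOn (fun t => e.det (update (fun j => L t (f t j)) i (L t (σ t))) /
      e.det (fun j => L t (f t j))) R₀ := hnum.div hden hne
  have hq' : ContinuousOn (fun t => c t i) R₀ := hq.congr fun t ht => hformula t ht
  exact (hq'.continuousWithinAt (mem_of_mem_nhdsWithin ht₀ hR₀)).mono_of_mem_nhdsWithin hR₀

end Abstract

/-! ### Chart readings of sections of the tangent bundle along a map -/

section Reading

variable {E : Type*} [NormedAddCommGroup E] [NormedSpace ℝ E] {H : Type*} [TopologicalSpace H]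
  {I : ModelWithCorners ℝ E H} {M : Type*} [TopologicalSpace M] [ChartedSpace H M]
  [IsManifold I ∞ M] {T : Type*} [TopologicalSpace T]

/-- A section of `TM` along a map which is continuous into `TM` has continuous base map.
[folklore] -/
theorem ContinuousOn.base_of_totalSpaceMk {G : T → M} {σ : T → E} {R : Set T}
    (h : ContinuousOn (fun t => (TotalSpace.mk' E (G t) (σ t) : TangentBundle I M)) R) :
    ContinuousOn G R :=
  (FiberBundle.continuous_proj E (TangentSpace I)).comp_continuousOn h

/-- The reading at `x₀` of an element of `TM` over the chart domain of `x₀` is the fibre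
component of the trivialization at `x₀`. [folklore] -/
theorem trivializationAt_tangent_snd {x₀ y : M} (v : TangentSpace I y) :
    ((trivializationAt E (TangentSpace I) x₀) (TotalSpace.mk' E y v)).2 =
      tangentCoordChange I y x₀ y v := by
  rw [TangentBundle.trivializationAt_apply, tangentCoordChange_def]
  rfl

/-- **Continuous sections along a map have continuous chart readings**: if
`t ↦ (G t, σ t)` is continuous into `TM` on `R` and `G` maps `R` into the chart domain of `x₀`,
then `t ↦ σ t` read in the chart at `x₀` is continuous on `R`. [folklore] -/
theorem ContinuousOn.tangentCoordChange_section {G : T → M} {σ : T → E} {R : Set T}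
    (h : ContinuousOn (fun t => (TotalSpace.mk' E (G t) (σ t) : TangentBundle I M)) R)
    {x₀ : M} (hG : MapsTo G R (chartAt H x₀).source) :
    ContinuousOn (fun t => tangentCoordChange I (G t) x₀ (G t) (σ t)) R := by
  set e := trivializationAt E (TangentSpace I) x₀ with he
  have h1 : ContinuousOn (fun t => (e (TotalSpace.mk' E (G t) (σ t))).2) R := by
    refine continuous_snd.comp_continuousOn (e.toOpenPartialHomeomorph.continuousOn.comp h ?_)
    intro t ht
    show TotalSpace.mk' E (G t) (σ t) ∈ e.source
    rw [e.mem_source, he, TangentBundle.trivializationAt_baseSet]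
    exact hG ht
  exact h1.congr fun t _ => (trivializationAt_tangent_snd (σ t)).symm

/-- **Continuous chart readings give continuous sections along a map**: if `G` is continuous on
`R` with values in the chart domain of `x₀` and the reading of `σ` at `x₀` is continuous on `R`,
then `t ↦ (G t, σ t)` is continuous into `TM` on `R`. [folklore] -/
theorem continuousOn_totalSpaceMk_of_tangentCoordChange {G : T → M} {σ : T → E} {R : Set T}
    (hG : ContinuousOn G R) {x₀ : M} (hmap : MapsTo G R (chartAt H x₀).source)
    (hread : ContinuousOn (fun t => tangentCoordChange I (G t) x₀ (G t) (σ t)) R) :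
    ContinuousOn (fun t => (TotalSpace.mk' E (G t) (σ t) : TangentBundle I M)) R := by
  set e := trivializationAt E (TangentSpace I) x₀ with he
  have hbase : e.baseSet = (chartAt H x₀).source := TangentBundle.trivializationAt_baseSet x₀
  have hsrc : ∀ t ∈ R, (TotalSpace.mk' E (G t) (σ t) : TangentBundle I M) ∈ e.source :=
    fun t ht => by rw [e.mem_source, hbase]; exact hmap ht
  have heq : ∀ t ∈ R, (TotalSpace.mk' E (G t) (σ t) : TangentBundle I M) =
      e.toOpenPartialHomeomorph.symm (G t, tangentCoordChange I (G t) x₀ (G t) (σ t)) := by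
    intro t ht
    have h1 : e (TotalSpace.mk' E (G t) (σ t)) =
        (G t, tangentCoordChange I (G t) x₀ (G t) (σ t)) :=
      Prod.ext (e.coe_fst (hsrc t ht)) (trivializationAt_tangent_snd (σ t))
    rw [← h1]
    exact (e.toOpenPartialHomeomorph.left_inv (hsrc t ht)).symm
  have htgt : MapsTo (fun t => (G t, tangentCoordChange I (G t) x₀ (G t) (σ t))) R
      e.toOpenPartialHomeomorph.target := by
    intro t ht
    show (G t, tangentCoordChange I (G t) x₀ (G t) (σ t)) ∈ e.target
    rw [e.mem_target, hbase]
    exact hmap ht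
  exact (e.toOpenPartialHomeomorph.continuousOn_symm.comp (hG.prodMk hread) htgt).congr heq

/-- **Continuous combinations of continuous sections along a map are continuous**: if the
sections `F i` along `G` are continuous into `TM` on `R` and the coefficients `c i` are
continuous on `R`, so is `∑ i, c i • F i`. [folklore] -/
theorem continuousOn_totalSpaceMk_sum_smul {k : ℕ} {G : T → M} {F : Fin k → T → E}
    {c : Fin k → T → ℝ} {R : Set T} (hG : ContinuousOn G R)
    (hF : ∀ i, ContinuousOn (fun t => (TotalSpace.mk' E (G t) (F i t) : TangentBundle I M)) R)
    (hc : ∀ i, ContinuousOn (c i) R) :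
    ContinuousOn (fun t =>
      (TotalSpace.mk' E (G t) (∑ i, c i t • F i t) : TangentBundle I M)) R := by
  intro t₀ ht₀
  set x₀ := G t₀ with hx₀
  set R₀ := R ∩ G ⁻¹' (chartAt H x₀).source with hR₀
  have hR₀ : R₀ ∈ 𝓝[R] t₀ :=
    inter_mem self_mem_nhdsWithin (hG.continuousWithinAt ht₀ |>.preimage_mem_nhdsWithin
      ((chartAt H x₀).open_source.mem_nhds (mem_chart_source H x₀)))
  have hmap : MapsTo G R₀ (chartAt H x₀).source := fun t ht => ht.2
  have hread : ContinuousOn (fun t => tangentCoordChange I (G t) x₀ (G t) (∑ i, c i t • F i t))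
      R₀ := by
    have h1 : ∀ i, ContinuousOn (fun t => c i t • tangentCoordChange I (G t) x₀ (G t) (F i t))
        R₀ := fun i =>
      ((hc i).mono inter_subset_left).smul
        (ContinuousOn.tangentCoordChange_section ((hF i).mono inter_subset_left) hmap)
    have h2 := continuousOn_finsetSum (Finset.univ : Finset (Fin k)) fun i _ => h1 i
    refine h2.congr fun t _ => ?_
    simp [map_sum, map_smul]
  have key := continuousOn_totalSpaceMk_of_tangentCoordChange (hG.mono inter_subset_left) hmap
    hread
  exact (key.continuousWithinAt ⟨ht₀, mem_chart_source H x₀⟩).mono_of_mem_nhdsWithin hR₀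

/-- **Continuity of coordinates in a continuously moving frame of the tangent bundle along a
map.**  Let `f t = (f t i)_{i < n}`, `n = dim E`, be a frame of `T_{G t} M` and `σ t ∈ T_{G t} M`,
all continuous into `TM` on `R` as functions of `t`.  Then the coordinates of `σ t` in the frame
`f t` are continuous on `R`. [cite: Steenrod1951, §7] -/
theorem exists_continuousOn_coord_of_frame [FiniteDimensional ℝ E] {n : ℕ}
    (hn : finrank ℝ E = n) {G : T → M} {f : T → Fin n → E} {σ : T → E} {R : Set T}
    (hf : ∀ i, ContinuousOn (fun t => (TotalSpace.mk' E (G t) (f t i) : TangentBundle I M)) R)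
    (hσ : ContinuousOn (fun t => (TotalSpace.mk' E (G t) (σ t) : TangentBundle I M)) R)
    (hli : ∀ t ∈ R, LinearIndependent ℝ (f t)) :
    ∃ c : T → Fin n → ℝ, (∀ i, ContinuousOn (fun t => c t i) R) ∧
      (∀ t ∈ R, σ t = ∑ i, c t i • f t i) ∧
      (∀ t ∈ R, ∀ d : Fin n → ℝ, σ t = ∑ i, d i • f t i → d = c t) := by
  have hG : ContinuousOn G R := ContinuousOn.base_of_totalSpaceMk hσ
  refine exists_continuousOn_coord hn hli fun t₀ ht₀ => ?_
  set x₀ := G t₀ with hx₀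
  set R₀ := R ∩ G ⁻¹' (chartAt H x₀).source with hR₀
  have hR₀ : R₀ ∈ 𝓝[R] t₀ :=
    inter_mem self_mem_nhdsWithin (hG.continuousWithinAt ht₀ |>.preimage_mem_nhdsWithin
      ((chartAt H x₀).open_source.mem_nhds (mem_chart_source H x₀)))
  have hmap : MapsTo G R₀ (chartAt H x₀).source := fun t ht => ht.2
  refine ⟨R₀, inter_subset_left, hR₀, fun t => tangentCoordChange I (G t) x₀ (G t),
    fun t ht => ?_,
    fun i => ContinuousOn.tangentCoordChange_section ((hf i).mono inter_subset_left) hmap,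
    ContinuousOn.tangentCoordChange_section (hσ.mono inter_subset_left) hmap⟩
  -- the reading is injective: changing back to the chart at `G t` undoes it
  have hmem : G t ∈ (extChartAt I (G t)).source ∩ (extChartAt I x₀).source ∩
      (extChartAt I (G t)).source := by
    simp only [extChartAt_source]
    exact ⟨⟨mem_chart_source H (G t), ht.2⟩, mem_chart_source H (G t)⟩
  intro v w hvw
  have hv := tangentCoordChange_comp (v := v) hmem
  have hw := tangentCoordChange_comp (v := w) hmem
  rw [tangentCoordChange_self (by simp)] at hv hw
  rw [← hv, ← hw]
  exact congrArg _ hvw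

end Reading

/-! ### Smooth local sections with prescribed chart reading -/

section LocalSection

variable {E : Type*} [NormedAddCommGroup E] [NormedSpace ℝ E] {H : Type*} [TopologicalSpace H]
  {I : ModelWithCorners ℝ E H} {M : Type*} [TopologicalSpace M] [ChartedSpace H M]
  [IsManifold I ∞ M]

/-- **A smooth local section with prescribed chart reading.**  If `g : M → E` is `C^∞` on an
open subset `O` of the chart domain of `x₀`, then `y ↦ tangentCoordChange I x₀ y y (g y)` — the
vector at `y` whose reading in the chart at `x₀` is `g y` — is a `C^∞` section of `TM` on `O`.
[folklore] -/
theorem contMDiffOn_sectionOfCoords {x₀ : M} {g : M → E} {O : Set M}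
    (hO : IsOpen O) (hOs : O ⊆ (chartAt H x₀).source) (hg : ContMDiffOn I 𝓘(ℝ, E) ∞ g O) :
    ContMDiffOn I I.tangent ∞
      (fun y => (TotalSpace.mk' E y (tangentCoordChange I x₀ y y (g y)) : TangentBundle I M)) O := by
  set e := trivializationAt E (TangentSpace I) x₀ with he
  have hbase : e.baseSet = (chartAt H x₀).source := TangentBundle.trivializationAt_baseSet x₀
  have hOb : O ⊆ e.baseSet := by rw [hbase]; exact hOs
  refine (e.contMDiffOn_section_iff hO hOb).2 (hg.congr fun y hy => ?_)
  show (e (TotalSpace.mk' E y (tangentCoordChange I x₀ y y (g y)))).2 = g y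
  rw [trivializationAt_tangent_snd, tangentCoordChange_tangentCoordChange (hOs hy)]

/-- **Smooth sections have smooth chart readings**: a `C^∞` section of `TM` on an open subset
`O` of the chart domain of `x₀` has `C^∞` reading at `x₀` on `O`. [folklore] -/
theorem ContMDiffOn.tangentCoordChange_section {x₀ : M} {V : Π y : M, TangentSpace I y}
    {O : Set M} (hO : IsOpen O) (hOs : O ⊆ (chartAt H x₀).source)
    (hV : ContMDiffOn I I.tangent ∞ (fun y => (TotalSpace.mk' E y (V y) : TangentBundle I M)) O) :
    ContMDiffOn I 𝓘(ℝ, E) ∞ (fun y => tangentCoordChange I y x₀ y (V y)) O := by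
  set e := trivializationAt E (TangentSpace I) x₀ with he
  have hbase : e.baseSet = (chartAt H x₀).source := TangentBundle.trivializationAt_baseSet x₀
  have hOb : O ⊆ e.baseSet := by rw [hbase]; exact hOs
  exact ((e.contMDiffOn_section_iff hO hOb).1 hV).congr fun y _ =>
    (trivializationAt_tangent_snd (V y)).symm

/-- **A smooth local section through a prescribed vector**: `y ↦ tangentCoordChange I x₀ y y w`
is a `C^∞` section of `TM` on the chart domain of `x₀` taking the value `w` at `x₀`. [folklore] -/
theorem contMDiffOn_sectionOfCoords_const (x₀ : M) (w : E) :
    ContMDiffOn I I.tangent ∞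
      (fun y => (TotalSpace.mk' E y (tangentCoordChange I x₀ y y w) : TangentBundle I M))
      (chartAt H x₀).source ∧ tangentCoordChange I x₀ x₀ x₀ w = w :=
  ⟨contMDiffOn_sectionOfCoords (chartAt H x₀).open_source Subset.rfl contMDiffOn_const,
    tangentCoordChange_self (by simp)⟩

end LocalSection

/-! ### Readings of smooth sections along smooth maps; extending a pushed-forward field -/

section Along

variable {E : Type*} [NormedAddCommGroup E] [NormedSpace ℝ E] {H : Type*} [TopologicalSpace H]
  {I : ModelWithCorners ℝ E H} {M : Type*} [TopologicalSpace M] [ChartedSpace H M]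
  [IsManifold I ∞ M]
  {E' : Type*} [NormedAddCommGroup E'] [NormedSpace ℝ E'] {H' : Type*} [TopologicalSpace H']
  {J : ModelWithCorners ℝ E' H'} {N : Type*} [TopologicalSpace N] [ChartedSpace H' N]
  [IsManifold J ∞ N]

omit [IsManifold I ∞ M] in
/-- **Smooth sections along a map have smooth chart readings**: if `y ↦ (Ψ y, w y)` is `C^∞`
into `TN` on `O` and `Ψ` maps `O` into the chart domain of `x₀`, then the reading
`y ↦ tangentCoordChange J (Ψ y) x₀ (Ψ y) (w y)` is `C^∞` on `O`. [folklore] -/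
theorem ContMDiffOn.tangentCoordChange_along {Ψ : M → N} {w : M → E'} {O : Set M}
    (hΨ : ContMDiffOn I J.tangent ∞ (fun y => (TotalSpace.mk' E' (Ψ y) (w y) : TangentBundle J N)) O)
    {x₀ : N} (hmap : MapsTo Ψ O (chartAt H' x₀).source) :
    ContMDiffOn I 𝓘(ℝ, E') ∞ (fun y => tangentCoordChange J (Ψ y) x₀ (Ψ y) (w y)) O := by
  set e := trivializationAt E' (TangentSpace J) x₀ with he
  have hbase : e.baseSet = (chartAt H' x₀).source := TangentBundle.trivializationAt_baseSet x₀
  have hsrc : MapsTo (fun y => (TotalSpace.mk' E' (Ψ y) (w y) : TangentBundle J N)) O e.source :=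
    fun y hy => by rw [e.mem_source, hbase]; exact hmap hy
  have h1 : ContMDiffOn I (J.prod 𝓘(ℝ, E')) ∞
      (fun y => e (TotalSpace.mk' E' (Ψ y) (w y))) O := e.contMDiffOn.comp hΨ hsrc
  exact (contMDiff_snd.comp_contMDiffOn h1).congr fun y _ =>
    (trivializationAt_tangent_snd (w y)).symm

omit [IsManifold I ∞ M] in
/-- **The push-forward of a smooth vector field along a smooth map is a smooth section along the
map**: `y ↦ (f y, df_y (Y y))` is `C^∞` into `TN`. [folklore] -/
theorem contMDiff_totalSpaceMk_mfderiv_section [IsManifold I 1 M] {f : M → N}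
    (hf : ContMDiff I J ∞ f) {Y : Π y : M, TangentSpace I y}
    (hY : ContMDiff I I.tangent ∞ fun y => (TotalSpace.mk' E y (Y y) : TangentBundle I M)) :
    ContMDiff I J.tangent ∞ fun y =>
      (TotalSpace.mk' E' (f y) (mfderiv I J f y (Y y)) : TangentBundle J N) :=
  (hf.contMDiff_tangentMap (by simp)).comp hY

omit [IsManifold I ∞ M] [IsManifold J ∞ N] in
/-- **A local smooth left inverse of an immersion** (from the immersion charts of
`Manifold.IsImmersionAt`: in them `f` reads `u ↦ L (u, 0)`, and `r = φ⁻¹ ∘ pr₁ ∘ L⁻¹ ∘ χ`): there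
are an open `O ∋ f x` in `N`, a map `r : N → M` which is `C^n` on `O`, and an open `U ∋ x` with
`f(U) ⊆ O` and `r (f y) = y` for `y ∈ U`. [folklore] -/
theorem exists_local_leftInverse_of_isImmersionAt [I.Boundaryless] {n : WithTop ℕ∞} {f : M → N}
    {x : M}
    (hm : Manifold.IsImmersionAt I J n f x) :
    ∃ O : Set N, IsOpen O ∧ f x ∈ O ∧ ∃ r : N → M, ContMDiffOn J I n r O ∧
      ∃ U : Set M, IsOpen U ∧ x ∈ U ∧ MapsTo f U O ∧ ∀ y ∈ U, r (f y) = y := by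
  -- the formula `φ.extend I y = (L.symm (χ.extend J (f y))).1` on `φ.source`
  have key : ∀ y ∈ hm.domChart.source,
      (hm.equiv.symm (hm.codChart.extend J (f y))).1 = hm.domChart.extend I y := by
    intro y hy
    have hy' : y ∈ (hm.domChart.extend I).source := by rwa [OpenPartialHomeomorph.extend_source]
    have hw := hm.writtenInCharts ((hm.domChart.extend I).map_source hy')
    simp only [comp_apply, (hm.domChart.extend I).left_inv hy'] at hw
    rw [hw, ContinuousLinearEquiv.symm_apply_apply]
  -- the coordinate map `g = pr₁ ∘ L⁻¹ ∘ χ`, smooth on `χ.source`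
  set g : N → E := fun z => (hm.equiv.symm (hm.codChart.extend J z)).1 with hg
  have hgs : ContMDiffOn J 𝓘(ℝ, E) n g hm.codChart.source := by
    have h1 : ContMDiffOn J 𝓘(ℝ, E') n (hm.codChart.extend J) hm.codChart.source :=
      hm.codChart.contMDiffOn_extend hm.codChart_mem_maximalAtlas
    have h2 : ContMDiff 𝓘(ℝ, E') 𝓘(ℝ, E) n (Prod.fst ∘ (hm.equiv.symm : E' → E × _)) := by
      rw [contMDiff_iff_contDiff]
      exact contDiff_fst.comp hm.equiv.symm.contDiff
    exact h2.comp_contMDiffOn h1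
  -- the open set `O`
  set O : Set N := hm.codChart.source ∩ g ⁻¹' (hm.domChart.extend I).target with hO
  have hOo : IsOpen O := hgs.continuousOn.isOpen_inter_preimage hm.codChart.open_source
    (hm.domChart.isOpen_extend_target (I := I))
  have hfO : MapsTo f hm.domChart.source O := by
    intro y hy
    refine ⟨hm.source_subset_preimage_source hy, ?_⟩
    show g (f y) ∈ (hm.domChart.extend I).target
    rw [hg]
    dsimp only
    rw [key y hy]
    exact (hm.domChart.extend I).map_source (by rwa [OpenPartialHomeomorph.extend_source])
  refine ⟨O, hOo, hfO hm.mem_domChart_source, (hm.domChart.extend I).symm ∘ g, ?_,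
    hm.domChart.source, hm.domChart.open_source, hm.mem_domChart_source, hfO, fun y hy => ?_⟩
  · refine (contMDiffOn_extend_symm hm.domChart_mem_maximalAtlas).comp (hgs.mono inter_subset_left)
      fun z hz => ?_
    show g z ∈ I '' hm.domChart.target
    rw [I.image_eq, ← OpenPartialHomeomorph.extend_target]
    exact hz.2
  · show (hm.domChart.extend I).symm (g (f y)) = y
    rw [hg]
    dsimp only
    rw [key y hy]
    exact (hm.domChart.extend I).left_inv (by rwa [OpenPartialHomeomorph.extend_source])

omit [IsManifold I ∞ M] in
/-- **Extending the push-forward of a vector field off an immersed sheet.**  Let `f : M → N` be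
`C^∞` and a `C^∞` immersion at `x`, and `Y` a `C^∞` vector field on `M`.  Then there are an open
`O ∋ f x`, a `C^∞` section `S` of `TN` on `O`, and an open `U ∋ x` with `f(U) ⊆ O` and
`S (f y) = df_y (Y y)` for all `y ∈ U` (the field `df (Y ∘ r)` transported from the foot
`f (r z)` to `z` in a chart, `r` a local left inverse of `f`). [folklore] -/
theorem exists_section_extending_pushforward [I.Boundaryless] [IsManifold I 1 M] {f : M → N}
    (hf : ContMDiff I J ∞ f) {x : M} (hm : Manifold.IsImmersionAt I J ∞ f x)
    {Y : Π y : M, TangentSpace I y}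
    (hY : ContMDiff I I.tangent ∞ fun y => (TotalSpace.mk' E y (Y y) : TangentBundle I M)) :
    ∃ O : Set N, IsOpen O ∧ f x ∈ O ∧ ∃ S : Π z : N, TangentSpace J z,
      ContMDiffOn J J.tangent ∞ (fun z => (TotalSpace.mk' E' z (S z) : TangentBundle J N)) O ∧
      ∃ U : Set M, IsOpen U ∧ x ∈ U ∧ MapsTo f U O ∧ ∀ y ∈ U, S (f y) = mfderiv I J f y (Y y) := by
  obtain ⟨O₁, hO₁, hxO₁, r, hr, U₁, hU₁, hxU₁, hfU₁, hrf⟩ :=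
    exists_local_leftInverse_of_isImmersionAt hm
  set x₀ : N := f x with hx₀
  -- the reading at `x₀` of the pushed field, a smooth function on `f ⁻¹' (chart domain of x₀)`
  set C : Set M := f ⁻¹' (chartAt H' x₀).source with hC
  have hCo : IsOpen C := (chartAt H' x₀).open_source.preimage hf.continuous
  set Φ : M → E' := fun y => tangentCoordChange J (f y) x₀ (f y) (mfderiv I J f y (Y y)) with hΦ
  have hΦs : ContMDiffOn I 𝓘(ℝ, E') ∞ Φ C :=
    ContMDiffOn.tangentCoordChange_along (contMDiff_totalSpaceMk_mfderiv_section hf hY).contMDiffOn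
      fun y hy => hy
  -- the open set `O` and the section `S z = (Φ (r z))` read back at `z`
  set O : Set N := O₁ ∩ (chartAt H' x₀).source ∩ r ⁻¹' C with hO
  have hO' : IsOpen O := by
    have h1 : IsOpen (O₁ ∩ (chartAt H' x₀).source) := hO₁.inter (chartAt H' x₀).open_source
    exact (hr.continuousOn.mono inter_subset_left).isOpen_inter_preimage h1 hCo
  have hxO : f x ∈ O := ⟨⟨hxO₁, mem_chart_source H' x₀⟩, by
    show r (f x) ∈ C
    rw [hrf x hxU₁]
    exact mem_chart_source H' x₀⟩
  set S : Π z : N, TangentSpace J z := fun z => tangentCoordChange J x₀ z z (Φ (r z)) with hS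
  have hSs : ContMDiffOn J J.tangent ∞ (fun z => (TotalSpace.mk' E' z (S z) : TangentBundle J N)) O :=
    contMDiffOn_sectionOfCoords hO' (fun z hz => hz.1.2)
      (hΦs.comp (hr.mono fun z hz => hz.1.1) fun z hz => hz.2)
  -- the neighbourhood `U` of `x`
  set U : Set M := U₁ ∩ f ⁻¹' O with hU
  have hUo : IsOpen U := hU₁.inter (hO'.preimage hf.continuous)
  refine ⟨O, hO', hxO, S, hSs, U, hUo, ⟨hxU₁, hxO⟩, fun y hy => hy.2, fun y hy => ?_⟩
  have hy0 : f y ∈ (chartAt H' x₀).source := hy.2.1.2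
  show tangentCoordChange J x₀ (f y) (f y) (Φ (r (f y))) = mfderiv I J f y (Y y)
  rw [hrf y hy.1, hΦ]
  dsimp only
  have hmem : f y ∈ (extChartAt J (f y)).source ∩ (extChartAt J x₀).source ∩
      (extChartAt J (f y)).source := by
    simp only [extChartAt_source]
    exact ⟨⟨mem_chart_source H' (f y), hy0⟩, mem_chart_source H' (f y)⟩
  rw [tangentCoordChange_comp hmem, tangentCoordChange_self (by simp)]

end Along

end Literature.Topology.FourManifolds
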